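import Summits.Ventures.PercRepro.ProfileGapMonoThresholdWeakAverageSupply

/-!
# PercRepro — THE PER-SET BOUNDS OF THE WEAK AVERAGED STEP AT `(2, 3)` ON A LOOPLESS MATROID
(p5, gen 27; `proofs/P5-GM1.md` §27)

For a rank-`1` set `B` (class `P = clF N B`, `X = E ∖ B`, `m = ρ(X)`, `κ = #coloops X`, `Y = E ∖ P`) the demand
`#E · [4 ≤ m] m` is paid by the surviving demand `(#X − κ) [4 ≤ m] m + κ [4 ≤ m − 1] (m − 1)` of the deletions
plus the shares of the up-sets (`ProfileGapMonoThresholdWeakAverageSupply`):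
* a singleton of a class with `≥ 2` points pays up to `2` short when `m ≥ 5` (`point_bound_singleton_big`) — and
  nothing short when `m = 4` (the full shares of the coloops outside the class; `κ ≤ 2` forces `#Y ≥ 4`,
  `three_le_card_coloops_of_card_le`);
* a singleton class is the simple case (`point_bound_singleton_small`, through `weakAvg_point_arith`);
* a set with `≥ 2` points pays in full (`point_bound_two_le`), and the full class `P` pays `2 #P` extra
  (`point_bound_class`), which covers the deficits of its singletons.
-/

open scoped Matroid

namespace PercRepro.Cogirth

open Finset ThmH Skew Shadow Profile

variable {α : Type} [DecidableEq α] {N : Matroid α} [N.Finite]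

section PointBounds

/-- If `ρ(E∖B) = 4` and at most `3` points lie outside the class, those points are all coloops of `E ∖ B`
(`ρ((E∖B)∖x) ≤ ρ(P∖B) + ρ(Y∖x) ≤ 3`): `κ ≥ 3`. -/
theorem three_le_card_coloops_of_card_le {B : Finset α} (hB : B ∈ Rq N 1) (h4 : rk N (gr N \ B) = 4)
    (hY : (gr N \ clF N B).card ≤ 3) : 3 ≤ (coloops N (gr N \ B)).card := by
  have hBg : B ⊆ gr N := (mem_Rq.1 hB).1
  have h1 : rk N B = 1 := rk_eq_of_eRk_eq_cq (mem_Rq.1 hB).2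
  have hX : gr N \ B ⊆ gr N := sdiff_subset
  have hYr := rk_sdiff_le_rk_sdiff_clF_add_one (N := N) h1 B
  have hYc : rk N (gr N \ clF N B) ≤ (gr N \ clF N B).card := rk_le_card _
  have hY3 : (gr N \ clF N B).card = 3 := by omega
  have hsub : gr N \ clF N B ⊆ coloops N (gr N \ B) := by
    intro x hx
    have hxg : x ∈ gr N := (mem_sdiff.1 hx).1
    have hxP : x ∉ clF N B := (mem_sdiff.1 hx).2
    have hxX : x ∈ gr N \ B := mem_sdiff.2 ⟨hxg, fun h => hxP (subset_clF hBg h)⟩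
    apply mem_coloops_of_rk_erase hX hxX
    have hcover : (gr N \ B).erase x ⊆ (clF N B \ B) ∪ (gr N \ clF N B).erase x := by
      intro z hz
      rw [mem_erase, mem_sdiff] at hz
      rw [mem_union, mem_sdiff, mem_erase, mem_sdiff]
      by_cases hzP : z ∈ clF N B
      · exact Or.inl ⟨hzP, hz.2.2⟩
      · exact Or.inr ⟨hz.1, hz.2.1, hzP⟩
    have hr1 : rk N (clF N B \ B) ≤ 1 := by
      have := rk_mono' (M := N) (sdiff_subset : clF N B \ B ⊆ clF N B)
      rw [rk_clF, h1] at this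
      exact this
    have hr2 : rk N ((gr N \ clF N B).erase x) ≤ 2 := by
      have := rk_le_card (M := N) ((gr N \ clF N B).erase x)
      rw [card_erase_of_mem hx, hY3] at this
      exact this
    have hr3 := rk_mono' (M := N) hcover
    have hr4 := rk_union_le (M := N) (clF N B \ B) ((gr N \ clF N B).erase x)
    have hr5 := rk_le_rk_erase_add_one (M := N) hX hxX
    omega
  have := card_le_card hsub
  omega

/-- The arithmetic of a demanding set at `ρ(E∖B) ≥ 5`: with `x = #(E∖B)`, `m = ρ(E∖B)`, `k = κ`, the demand
`(x + 1) m` is the surviving demand `(x − k) m + k (m − 1)` plus `m + k`. -/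
theorem weakAvg_arith_ge_five (x m k s : ℕ) (h5 : 5 ≤ m) (hkx : k ≤ x) (hs : m + k ≤ s) :
    (x + 1) * m ≤ (x - k) * m + k * (m - 1) + s := by
  obtain ⟨d, rfl⟩ : ∃ d, x = k + d := ⟨x - k, by omega⟩
  obtain ⟨e, rfl⟩ : ∃ e, m = e + 1 := ⟨m - 1, by omega⟩
  rw [Nat.add_sub_cancel_left, Nat.add_sub_cancel]
  nlinarith [hs]

/-- **A singleton of a class with `≥ 2` points**: its demand is paid by its surviving demand and its shares, up
to `2` when `ρ(E∖b) ≥ 5` and exactly when `ρ(E∖b) = 4`. -/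
theorem point_bound_singleton_big (hloop : ∀ x ∈ gr N, rk N {x} = 1) {b : α} (hb : b ∈ gr N)
    (hP : 2 ≤ (clF N {b}).card) :
    (gr N).card * (if 4 ≤ rk N (gr N \ {b}) then rk N (gr N \ {b}) else 0) ≤
      ((gr N \ {b}).card - (coloops N (gr N \ {b})).card) *
          (if 4 ≤ rk N (gr N \ {b}) then rk N (gr N \ {b}) else 0) +
        (coloops N (gr N \ {b})).card *
          (if 4 ≤ rk N (gr N \ {b}) - 1 then rk N (gr N \ {b}) - 1 else 0) +
      (∑ y ∈ gr N \ clF N {b},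
        (if ({b} : Finset α).card = 1 ∧ 4 ≤ rk N (gr N \ {y}) then 1 else 2) *
          ((insert y ({b} : Finset α)).card +
            (if rk N (gr N \ insert y {b}) = 3 then (coloops N (gr N \ insert y {b})).card else 0))) +
      (if 5 ≤ rk N (gr N \ {b}) then 2 else 0) := by
  have hbg : ({b} : Finset α) ⊆ gr N := singleton_subset_iff.2 hb
  have hB : ({b} : Finset α) ∈ Rq N 1 := by
    rw [mem_Rq]
    exact ⟨hbg, eRk_eq_of_rk_eq_cq (hloop b hb)⟩
  have h1 : rk N {b} = 1 := hloop b hb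
  have hX : gr N \ {b} ⊆ gr N := sdiff_subset
  have hXc : (gr N \ {b}).card = (gr N).card - 1 := by
    rw [card_sdiff_of_subset hbg, card_singleton]
  have hn1 : 1 ≤ (gr N).card := card_pos.2 ⟨b, hb⟩
  have hnX : (gr N).card = (gr N \ {b}).card + 1 := by omega
  have hm : rk N (gr N \ {b}) ≤ (gr N \ clF N {b}).card + 1 := by
    have := rk_sdiff_le_rk_sdiff_clF_add_one (N := N) h1 {b}
    have := rk_le_card (M := N) (gr N \ clF N {b})
    omega
  have hκm : (coloops N (gr N \ {b})).card ≤ rk N (gr N \ {b}) := card_coloops_le_rk hX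
  have hκX : (coloops N (gr N \ {b})).card ≤ (gr N \ {b}).card := card_le_card (coloops_subset _)
  have hsupply := (sum_h_insert_ge hB).trans (supply_ge_sum_h (N := N) {b})
  rw [card_singleton] at hsupply
  rw [hnX]
  by_cases h5 : 5 ≤ rk N (gr N \ {b})
  · rw [if_pos (by omega), if_pos (by omega), if_pos h5]
    -- `m + κ ≤ 2 #Y + 2 ≤ supply + 2`
    have hsup2 : (gr N \ clF N {b}).card * (1 + 1) ≤ ∑ y ∈ gr N \ clF N {b},
        (if ({b} : Finset α).card = 1 ∧ 4 ≤ rk N (gr N \ {y}) then 1 else 2) *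
          ((insert y ({b} : Finset α)).card +
            (if rk N (gr N \ insert y {b}) = 3 then (coloops N (gr N \ insert y {b})).card else 0)) :=
      le_trans (Nat.le_add_right _ _) hsupply
    have key := weakAvg_arith_ge_five (gr N \ {b}).card (rk N (gr N \ {b})) (coloops N (gr N \ {b})).card
      ((∑ y ∈ gr N \ clF N {b},
        (if ({b} : Finset α).card = 1 ∧ 4 ≤ rk N (gr N \ {y}) then 1 else 2) *
          ((insert y ({b} : Finset α)).card +
            (if rk N (gr N \ insert y {b}) = 3 then (coloops N (gr N \ insert y {b})).card else 0))) + 2)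
      h5 hκX (by omega)
    omega
  · by_cases h4 : rk N (gr N \ {b}) = 4
    · rw [if_pos (by omega), if_neg (by omega), if_neg h5, h4]
      -- `4 + 4 κ ≤ supply`, with the full shares of the coloops outside the class
      have hbig := supply_ge_singleton_big hloop hb hP h4
      have hF := card_coloops_sdiff_le_filter_add_one (N := N) hloop h1
      have hY3 : 3 ≤ (gr N \ clF N {b}).card := by omega
      have hκ3 : (gr N \ clF N {b}).card ≤ 3 → 3 ≤ (coloops N (gr N \ {b})).card :=
        fun h => three_le_card_coloops_of_card_le hB h4 h
      set Y := (gr N \ clF N {b}).card with hYdef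
      set κ := (coloops N (gr N \ {b})).card with hκdef
      set F := ((coloops N (gr N \ {b})).filter (fun y => y ∉ clF N {b})).card with hFdef
      -- the arithmetic: `4 + 4κ ≤ 2Y + 2κF` with `F + 1 ≥ κ`, `Y ≥ 3`, `(κ ≤ 2 → Y ≥ 4)`
      have hcore : 4 + 4 * κ ≤ 2 * Y + 2 * κ * F := by
        rcases Nat.lt_or_ge κ 3 with hκ | hκ
        · have hY4 : 4 ≤ Y := by
            by_contra hc
            have := hκ3 (by omega)
            omega
          interval_cases κ <;> omega
        · have h6 : κ * κ ≤ κ * (F + 1) := Nat.mul_le_mul_left κ hF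
          have h7 : 3 * κ ≤ κ * κ := by nlinarith [hκ]
          nlinarith [h6, h7, hY3]
      omega
    · rw [if_neg (by omega), if_neg (by omega), if_neg h5]
      omega

/-- **A singleton class** (`clF N {b} = {b}`): the simple case, through `weakAvg_point_arith`. -/
theorem point_bound_singleton_small (hloop : ∀ x ∈ gr N, rk N {x} = 1) {b : α} (hb : b ∈ gr N)
    (hP : (clF N {b}).card = 1) :
    (gr N).card * (if 4 ≤ rk N (gr N \ {b}) then rk N (gr N \ {b}) else 0) ≤
      ((gr N \ {b}).card - (coloops N (gr N \ {b})).card) *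
          (if 4 ≤ rk N (gr N \ {b}) then rk N (gr N \ {b}) else 0) +
        (coloops N (gr N \ {b})).card *
          (if 4 ≤ rk N (gr N \ {b}) - 1 then rk N (gr N \ {b}) - 1 else 0) +
      ∑ y ∈ gr N \ clF N {b},
        (if ({b} : Finset α).card = 1 ∧ 4 ≤ rk N (gr N \ {y}) then 1 else 2) *
          ((insert y ({b} : Finset α)).card +
            (if rk N (gr N \ insert y {b}) = 3 then (coloops N (gr N \ insert y {b})).card else 0)) := by
  have hbg : ({b} : Finset α) ⊆ gr N := singleton_subset_iff.2 hb
  have hB : ({b} : Finset α) ∈ Rq N 1 := by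
    rw [mem_Rq]
    exact ⟨hbg, eRk_eq_of_rk_eq_cq (hloop b hb)⟩
  have hX : gr N \ {b} ⊆ gr N := sdiff_subset
  -- the class is `{b}` itself
  have hPeq : clF N {b} = {b} := by
    apply Subset.antisymm _ (subset_clF hbg)
    intro x hx
    have hcard := card_eq_one.1 hP
    obtain ⟨a, ha⟩ := hcard
    have hb' : b ∈ clF N {b} := subset_clF hbg (mem_singleton_self b)
    rw [ha, mem_singleton] at hx hb'
    rw [mem_singleton, hx, hb']
  have hXc : (gr N \ {b}).card = (gr N).card - 1 := by
    rw [card_sdiff_of_subset hbg, card_singleton]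
  have hn1 : 1 ≤ (gr N).card := card_pos.2 ⟨b, hb⟩
  have hnX : (gr N).card = (gr N \ {b}).card + 1 := by omega
  have hmx : rk N (gr N \ {b}) ≤ (gr N \ {b}).card := rk_le_card _
  have hkx : (coloops N (gr N \ {b})).card ≤ (gr N \ {b}).card := card_le_card (coloops_subset _)
  have h4 : rk N (gr N \ {b}) = 4 → (coloops N (gr N \ {b})).card = 4 ∨ 5 ≤ (gr N \ {b}).card := by
    intro h4
    by_cases h5 : 5 ≤ (gr N \ {b}).card
    · exact Or.inr h5
    · left
      have hXc4 : (gr N \ {b}).card = 4 := by omega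
      have hK : gr N \ {b} ⊆ coloops N (gr N \ {b}) := by
        intro z hz
        apply mem_coloops_of_rk_erase hX hz
        have h1 := rk_le_card (M := N) ((gr N \ {b}).erase z)
        rw [card_erase_of_mem hz, hXc4] at h1
        have h2 := rk_le_rk_erase_add_one hX hz
        omega
      have := card_le_card hK
      omega
  have hari := weakAvg_point_arith (gr N \ {b}).card (rk N (gr N \ {b})) (coloops N (gr N \ {b})).card hmx hkx h4
  -- the supply covers the shares of the arithmetic lemma
  have hsupply := (sum_h_insert_ge hB).trans (supply_ge_sum_h (N := N) {b})
  rw [card_singleton, hPeq] at hsupply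
  have hFeq : (coloops N (gr N \ {b})).filter (fun y => y ∉ ({b} : Finset α)) = coloops N (gr N \ {b}) := by
    apply filter_true_of_mem
    intro y hy
    exact (mem_sdiff.1 (coloops_subset _ hy)).2
  rw [hFeq] at hsupply
  rw [hPeq]
  rw [hnX]
  have hshare : (if 3 + 1 ≤ rk N (gr N \ {b}) then 2 * (gr N \ {b}).card else 0) +
      (if rk N (gr N \ {b}) = 4 then
        (coloops N (gr N \ {b})).card * ((coloops N (gr N \ {b})).card - 1) else 0) ≤
      ∑ y ∈ gr N \ {b},
        (if ({b} : Finset α).card = 1 ∧ 4 ≤ rk N (gr N \ {y}) then 1 else 2) *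
          ((insert y ({b} : Finset α)).card +
            (if rk N (gr N \ insert y {b}) = 3 then (coloops N (gr N \ insert y {b})).card else 0)) := by
    refine le_trans ?_ hsupply
    split_ifs with ha hb4 hb4 <;> first | omega | (rw [Nat.mul_comm ((coloops N (gr N \ {b})).card - 1)]; omega)
  have : (if 3 + 1 ≤ rk N (gr N \ {b}) then rk N (gr N \ {b}) else 0) =
      (if 4 ≤ rk N (gr N \ {b}) then rk N (gr N \ {b}) else 0) := rfl
  have h' : (if 3 + 1 ≤ rk N (gr N \ {b}) - 1 then rk N (gr N \ {b}) - 1 else 0) =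
      (if 4 ≤ rk N (gr N \ {b}) - 1 then rk N (gr N \ {b}) - 1 else 0) := rfl
  rw [this, h'] at hari
  omega

end PointBounds

section TwoLe

/-- The arithmetic of a demanding set of `b` points: with `x = #(E∖B)`, `m = ρ(E∖B) ≥ 1`, `k = κ`, the demand
`(x + b) m` is the surviving demand `(x − k) m + k (m − 1)` plus `b m + k`. -/
theorem weakAvg_arith_ge_one (x m k b s : ℕ) (hm : 1 ≤ m) (hkx : k ≤ x) (hs : b * m + k ≤ s) :
    (x + b) * m ≤ (x - k) * m + k * (m - 1) + s := by
  obtain ⟨d, rfl⟩ : ∃ d, x = k + d := ⟨x - k, by omega⟩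
  obtain ⟨e, rfl⟩ : ∃ e, m = e + 1 := ⟨m - 1, by omega⟩
  rw [Nat.add_sub_cancel_left, Nat.add_sub_cancel]
  nlinarith [hs]

/-- `4 k ≤ 2 k² + 2`. -/
theorem four_mul_le_two_mul_sq_add_two (k : ℕ) : 4 * k ≤ 2 * k * k + 2 := by
  rcases k with _ | k
  · omega
  · nlinarith

/-- **A set with at least two points pays in full**: its demand is at most its surviving demand plus its shares. -/
theorem point_bound_two_le (hloop : ∀ x ∈ gr N, rk N {x} = 1) {B : Finset α} (hB : B ∈ Rq N 1)
    (h2 : 2 ≤ B.card) :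
    (gr N).card * (if 4 ≤ rk N (gr N \ B) then rk N (gr N \ B) else 0) ≤
      ((gr N \ B).card - (coloops N (gr N \ B)).card) *
          (if 4 ≤ rk N (gr N \ B) then rk N (gr N \ B) else 0) +
        (coloops N (gr N \ B)).card *
          (if 4 ≤ rk N (gr N \ B) - 1 then rk N (gr N \ B) - 1 else 0) +
      ∑ y ∈ gr N \ clF N B,
        (if B.card = 1 ∧ 4 ≤ rk N (gr N \ {y}) then 1 else 2) *
          ((insert y B).card +
            (if rk N (gr N \ insert y B) = 3 then (coloops N (gr N \ insert y B)).card else 0)) := by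
  have hBg : B ⊆ gr N := (mem_Rq.1 hB).1
  have h1 : rk N B = 1 := rk_eq_of_eRk_eq_cq (mem_Rq.1 hB).2
  have hX : gr N \ B ⊆ gr N := sdiff_subset
  have hXc : (gr N \ B).card = (gr N).card - B.card := card_sdiff_of_subset hBg
  have hBn : B.card ≤ (gr N).card := card_le_card hBg
  have hnX : (gr N).card = (gr N \ B).card + B.card := by omega
  have hm : rk N (gr N \ B) ≤ (gr N \ clF N B).card + 1 := by
    have := rk_sdiff_le_rk_sdiff_clF_add_one (N := N) h1 B
    have := rk_le_card (M := N) (gr N \ clF N B)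
    omega
  have hκm : (coloops N (gr N \ B)).card ≤ rk N (gr N \ B) := card_coloops_le_rk hX
  have hκX : (coloops N (gr N \ B)).card ≤ (gr N \ B).card := card_le_card (coloops_subset _)
  have hF := card_coloops_sdiff_le_filter_add_one (N := N) hloop h1
  have hsupply := Nat.mul_le_mul_left 2 (sum_h_insert_ge hB)
  rw [supply_eq_two_mul_of_two_le h2] at hsupply
  -- `supply ≥ 2 (#Y (#B + 1) + [m = 4] (κ − 1) #F)`
  set Y := (gr N \ clF N B).card with hYdef
  set κ := (coloops N (gr N \ B)).card with hκdef
  set F := ((coloops N (gr N \ B)).filter (fun y => y ∉ clF N B)).card with hFdef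
  set S := ∑ y ∈ gr N \ clF N B,
        (if B.card = 1 ∧ 4 ≤ rk N (gr N \ {y}) then 1 else 2) *
          ((insert y B).card +
            (if rk N (gr N \ insert y B) = 3 then (coloops N (gr N \ insert y B)).card else 0)) with hSdef
  rw [hnX]
  by_cases h5 : 5 ≤ rk N (gr N \ B)
  · rw [if_pos (by omega), if_pos (by omega)]
    rw [if_neg (by omega)] at hsupply
    apply weakAvg_arith_ge_one _ _ _ _ _ (by omega) hκX
    -- `#B m + κ ≤ (#B + 1)(Y + 1) ≤ 2 Y (#B + 1) ≤ S`
    have hY1 : 1 ≤ Y := by omega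
    nlinarith [hsupply, hm, hκm, hY1]
  · by_cases h4 : rk N (gr N \ B) = 4
    · rw [if_pos (by omega), if_neg (by omega), h4]
      rw [if_pos h4] at hsupply
      have hY3 : 3 ≤ Y := by omega
      -- `4 #B + 4 κ ≤ 2 Y (#B + 1) + 2 (κ − 1) F`
      have hcore : 4 * B.card + 4 * κ ≤ 2 * (Y * (B.card + 1) + (κ - 1) * F) := by
        rcases Nat.eq_zero_or_pos κ with hκ0 | hκpos
        · rw [hκ0]; nlinarith [hY3]
        · obtain ⟨k, hk⟩ : ∃ k, κ = k + 1 := ⟨κ - 1, by omega⟩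
          rw [hk, Nat.add_sub_cancel]
          have hkF : k ≤ F := by omega
          have h6 : k * k ≤ k * F := Nat.mul_le_mul_left k hkF
          have h7 := four_mul_le_two_mul_sq_add_two k
          nlinarith [h6, h7, hY3]
      omega
    · rw [if_neg (by omega), if_neg (by omega)]
      omega

/-- **The full class pays `2 #P` extra** (`B = clF N B`, `#B ≥ 2`, `ρ(E∖B) ≥ 4`): every coloop of `E ∖ B` lies
outside the class and `ρ(E∖B) ≤ #(E∖B)`. -/
theorem point_bound_class {B : Finset α} (hB : B ∈ Rq N 1)
    (h2 : 2 ≤ B.card) (hBP : clF N B = B) (h4 : 4 ≤ rk N (gr N \ B)) :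
    (gr N).card * (if 4 ≤ rk N (gr N \ B) then rk N (gr N \ B) else 0) + 2 * B.card ≤
      ((gr N \ B).card - (coloops N (gr N \ B)).card) *
          (if 4 ≤ rk N (gr N \ B) then rk N (gr N \ B) else 0) +
        (coloops N (gr N \ B)).card *
          (if 4 ≤ rk N (gr N \ B) - 1 then rk N (gr N \ B) - 1 else 0) +
      ∑ y ∈ gr N \ clF N B,
        (if B.card = 1 ∧ 4 ≤ rk N (gr N \ {y}) then 1 else 2) *
          ((insert y B).card +
            (if rk N (gr N \ insert y B) = 3 then (coloops N (gr N \ insert y B)).card else 0)) := by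
  have hBg : B ⊆ gr N := (mem_Rq.1 hB).1
  have hX : gr N \ B ⊆ gr N := sdiff_subset
  have hXc : (gr N \ B).card = (gr N).card - B.card := card_sdiff_of_subset hBg
  have hBn : B.card ≤ (gr N).card := card_le_card hBg
  have hnX : (gr N).card = (gr N \ B).card + B.card := by omega
  have hm : rk N (gr N \ B) ≤ (gr N \ B).card := rk_le_card _
  have hκm : (coloops N (gr N \ B)).card ≤ rk N (gr N \ B) := card_coloops_le_rk hX
  have hκX : (coloops N (gr N \ B)).card ≤ (gr N \ B).card := card_le_card (coloops_subset _)
  have hsupply := Nat.mul_le_mul_left 2 (sum_h_insert_ge hB)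
  rw [supply_eq_two_mul_of_two_le h2] at hsupply
  -- with `clF N B = B`: the points outside the class are `E ∖ B`, and every coloop is outside
  have hFeq : (coloops N (gr N \ B)).filter (fun y => y ∉ clF N B) = coloops N (gr N \ B) := by
    apply filter_true_of_mem
    intro y hy
    rw [hBP]
    exact (mem_sdiff.1 (coloops_subset _ hy)).2
  rw [hFeq, hBP] at hsupply
  rw [hBP]
  set X := (gr N \ B).card with hXdef
  set κ := (coloops N (gr N \ B)).card with hκdef
  set S := ∑ y ∈ gr N \ B,
        (if B.card = 1 ∧ 4 ≤ rk N (gr N \ {y}) then 1 else 2) *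
          ((insert y B).card +
            (if rk N (gr N \ insert y B) = 3 then (coloops N (gr N \ insert y B)).card else 0)) with hSdef
  rw [hnX]
  by_cases h5 : 5 ≤ rk N (gr N \ B)
  · rw [if_pos (by omega), if_pos (by omega)]
    rw [if_neg (by omega)] at hsupply
    have key := weakAvg_arith_ge_one X (rk N (gr N \ B)) κ B.card (S - 2 * B.card) (by omega) hκX
      (by
        -- `#B m + κ + 2 #B ≤ #B X + X + 2 #B ≤ 2 X (#B + 1) ≤ S`
        have hX2 : 2 ≤ X := by omega
        have : B.card * rk N (gr N \ B) + κ + 2 * B.card ≤ S := by nlinarith [hsupply, hm, hκm, hX2]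
        omega)
    have hS2 : 2 * B.card ≤ S := by nlinarith [hsupply]
    omega
  · have h4' : rk N (gr N \ B) = 4 := by omega
    rw [if_pos (by omega), if_neg (by omega), h4']
    rw [if_pos h4'] at hsupply
    have hX4 : 4 ≤ X := by omega
    -- `6 #B + 4 κ ≤ 2 X (#B + 1) + 2 (κ − 1) κ`
    have hcore : 4 * B.card + 4 * κ + 2 * B.card ≤ 2 * (X * (B.card + 1) + (κ - 1) * κ) := by
      rcases Nat.lt_or_ge κ 4 with hκ | hκ
      · interval_cases κ <;> nlinarith [hX4]
      · obtain ⟨k, hk⟩ : ∃ k, κ = k + 4 := ⟨κ - 4, by omega⟩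
        have hk3 : k + 4 - 1 = k + 3 := by omega
        rw [hk, hk3]
        nlinarith [hX4]
    omega

end TwoLe

end PercRepro.Cogirth
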